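import Summits.BirchSwinnertonDyer.BirchSwinnertonDyer.Theorems.ErratumRoadFiveFixedPartTriangularReduction
import Literature.NumberTheory.GaloisRepresentations.LocalUnramifiedCharactersDensityProofs
import HarnessLib

/-!
# (FIX) from an ORDINARY FRAME on the local Galois group: finitely many `⟨P, σ₁⟩`-fixed vectors, assembled from the triangular
# reduction, the unramified-characters density lemma and the inertia structure (helper, `--supports stmt-BirchSwinnertonDyer-25505`)

Cell `bsd-stepL`, seat `bsd-stepL-imc-p1` (prover g23, 2026-08-28). Theorems only (no definition, no named fact, no `sorry`, no
instance, no notation). The ABSTRACT FINAL ASSEMBLY of the v6 stub (FIX) of line `erratum_chain` of crux 25505 (memo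
`LOCALDEFECT-25505-imc-p1-g23.md` §1bis): over the absolute Galois group `Γ_F` of a non-archimedean local field, let `ρ` act on an
`𝒪`-module `A` with a TRIANGULAR MODEL `Φ : A ≃ B × B`, `σ ↦ (χ(σ) e(σ); 0 δ(σ))` (the ordinary frame [Wiles88 Thm 2.2] in cofree
coordinates, `GreenbergSelmer.exists_cofree_coordinates`), `κ₁, κ₂ : Γ_F → ℤ_p` two characters PROPORTIONAL on inertia with `κ₂`
RAMIFIED (the cyclotomic and anticyclotomic restrictions at a split prime: `toAdd_mul_comm_of_mem_inertia_of_ncard_primesOver_eq`,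
`exists_mem_inertia_apply_ne_one_of_isAnticyclotomic`), `δ` multiplicative, continuous (through `𝒪 → L`), UNRAMIFIED, with
EXPONENT-SEPARATING Frobenius value (`δ(Frob) = α_p` not a root of unity: `PadicUnitPowers.*` + [Deligne]), some `σ₀ ∈ P = ker κ₁ ∩ ker κ₂`
with `χ(σ₀) − 1 ∈ 𝒪ˣ` (`ZpExtension.exists_localGroup_inertia_torsion_of_split` with `u = −1`: `χ(σ₀) = (−1)^{k−1} = −1`), and
`B[c]` finite for `c ≠ 0` (`finite_setOf_smul_quotient_eq_zero` + `finite_padicCoeffIntegers_quotient_span`). THEN for every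
`σ₁ ∈ ker κ₂ ∖ ker κ₁` only finitely many `a ∈ A` are fixed by `P` and `σ₁`:
`δ(σ₁) ≠ 1` by `IsNonarchimedeanLocalField.toAdd_eq_zero_of_unramified_of_apply_eq_one` applied to `ν = κ₂(τ₁)κ₁ − κ₁(τ₁)κ₂`
(unramified by proportionality, `ν(σ₁) = κ₂(τ₁)κ₁(σ₁) ≠ 0`), and `FixReduction.finite_fixed_of_triangular_model` concludes.

* `finite_fixed_of_frame` — the statement above. What remains for (FIX) at the erratum data is ONLY the production of the frame
  data from the named fact `Hida2000_thm326_ordinary_unitRoot` (transport to the datum and to `Γ_{K_𝔭̄}`).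

HONEST FRAMING: conditional on its displayed hypotheses; nothing about BSD for any pair; closes: none (T7).

## References
* [JetchevSkinnerWan2017] §3.3 Case 3(b), §3.4 L.3.4.1; [Wiles1988] Thm 2.2; [SerreLocalFields1979] IV §4 Cor. 2.
-/

noncomputable section

-- D-0017: single-problem summit, the namespace repeats the problem name by design.
set_option linter.dupNamespace false
set_option autoImplicit false

open Filter Topology Field
open Literature.NumberTheory.GaloisRepresentations Literature.NumberTheory.GaloisRepresentations.IsNonarchimedeanLocalField

namespace Summit.BirchSwinnertonDyer.BirchSwinnertonDyer.Theorems.ErratumThm23TwoVariable.FixAssembly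

/-- **(FIX) from an ordinary frame on `Γ_F`** (see the module docstring for the dictionary). [cite: JetchevSkinnerWan2017, §3.3 Case 3(b) and §3.4 Lemma 3.4.1 (arXiv:1512.06894 pp. 13–14)]
[cite: Wiles1988, Thm. 2.2] [cite: SerreLocalFields1979, Ch. IV §4 Cor. 2 to Prop. 16] -/
theorem finite_fixed_of_frame {F : Type} [Field F] [ValuativeRel F] [TopologicalSpace F] [IsNonarchimedeanLocalField F]
    {p : ℕ} [Fact p.Prime] {𝒪 : Type*} [CommRing 𝒪] {A : Type*} [AddCommGroup A] [Module 𝒪 A]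
    {B : Type*} [AddCommGroup B] [Module 𝒪 B] {L : Type*} [NormedField L]
    {R : Type*} [FunLike R (absoluteGaloisGroup F) (A →ₗ[𝒪] A)] (ρ : R)
    (κ₁ κ₂ : absoluteGaloisGroup F →ₜ* Multiplicative ℤ_[p])
    -- the triangular model (ordinary frame in cofree coordinates)
    (Φ : A ≃ₗ[𝒪] B × B) (χ e δ : absoluteGaloisGroup F → 𝒪)
    (hΦ : ∀ σ a, Φ (ρ σ a) = (χ σ • (Φ a).1 + e σ • (Φ a).2, δ σ • (Φ a).2))
    -- an element of `P = ker κ₁ ∩ ker κ₂` acting on the line with `χ − 1` a unit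
    (h₀ : ∃ σ, κ₁ σ = 1 ∧ κ₂ σ = 1 ∧ IsUnit (χ σ - 1))
    -- `δ`: multiplicative, continuous through `ι𝒪 : 𝒪 → L`, unramified, exponent-separating Frobenius value
    (ι𝒪 : 𝒪 →+* L) (hδmul : ∀ σ τ, δ (σ * τ) = δ σ * δ τ) (hδone : δ 1 = 1)
    (hδc : Continuous fun σ ↦ ι𝒪 (δ σ)) (hδI : ∀ τ ∈ absInertia F, δ τ = 1)
    {σ₀ : absoluteGaloisGroup F} (hσ₀ : IsAbsArithFrob σ₀)
    (hα : ∀ a : ℕ → ℕ, Tendsto (fun m ↦ (ι𝒪 (δ σ₀)) ^ (a m)) atTop (𝓝 1) →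
      Tendsto (fun m ↦ ((a m : ℕ) : ℤ_[p])) atTop (𝓝 0))
    -- inertia: proportionality of `κ₁, κ₂` and ramification of `κ₂`
    (hprop : ∀ σ ∈ absInertia F, ∀ τ ∈ absInertia F,
      (κ₁ σ).toAdd * (κ₂ τ).toAdd = (κ₂ σ).toAdd * (κ₁ τ).toAdd)
    (hram : ∃ τ ∈ absInertia F, κ₂ τ ≠ 1)
    -- torsion finiteness of the quotient line
    (hB : ∀ c : 𝒪, c ≠ 0 → {y : B | c • y = 0}.Finite)
    {σ₁ : absoluteGaloisGroup F} (h₁ : κ₂ σ₁ = 1) (h₁' : κ₁ σ₁ ≠ 1) :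
    {a : A | (∀ σ, κ₁ σ = 1 → κ₂ σ = 1 → ρ σ a = a) ∧ ρ σ₁ a = a}.Finite := by
  obtain ⟨τ₁, hτ₁I, hτ₁⟩ := hram
  -- the unramified combination `ν = κ₂(τ₁) κ₁ − κ₁(τ₁) κ₂`
  let ν : absoluteGaloisGroup F →ₜ* Multiplicative ℤ_[p] :=
    { toFun := fun σ ↦ Multiplicative.ofAdd ((κ₂ τ₁).toAdd * (κ₁ σ).toAdd - (κ₁ τ₁).toAdd * (κ₂ σ).toAdd)
      map_one' := by rw [map_one κ₁, map_one κ₂, toAdd_one, mul_zero, mul_zero, sub_zero, ofAdd_zero]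
      map_mul' := fun σ τ ↦ by
        rw [← ofAdd_add, map_mul κ₁, map_mul κ₂, toAdd_mul, toAdd_mul]; congr 1; ring
      continuous_toFun := continuous_ofAdd.comp
        ((continuous_const.mul (continuous_toAdd.comp (map_continuous κ₁))).sub
          (continuous_const.mul (continuous_toAdd.comp (map_continuous κ₂)))) }
  have hν : ∀ σ, (ν σ).toAdd = (κ₂ τ₁).toAdd * (κ₁ σ).toAdd - (κ₁ τ₁).toAdd * (κ₂ σ).toAdd := fun σ ↦ rfl
  have hνI : ∀ τ ∈ absInertia F, ν τ = 1 := by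
    intro τ hτ
    apply Multiplicative.toAdd.injective
    rw [hν, toAdd_one, hprop τ₁ hτ₁I τ hτ, mul_comm, sub_self]
  -- `δ` as a continuous monoid homomorphism into `L`
  let δ' : absoluteGaloisGroup F →* L :=
    { toFun := fun σ ↦ ι𝒪 (δ σ)
      map_one' := by rw [hδone, map_one]
      map_mul' := fun σ τ ↦ by rw [hδmul, map_mul] }
  have hδ' : ∀ σ, δ' σ = ι𝒪 (δ σ) := fun σ ↦ rfl
  have hδ'I : ∀ τ ∈ absInertia F, δ' τ = 1 := fun τ hτ ↦ by rw [hδ', hδI τ hτ, map_one]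
  -- `δ(σ₁) ≠ 1`: otherwise `ν(σ₁) = 0`, but `ν(σ₁) = κ₂(τ₁) κ₁(σ₁) ≠ 0`
  have hδσ₁ : δ σ₁ - 1 ≠ 0 := by
    intro h0
    have hδ1 : δ' σ₁ = 1 := by rw [hδ', sub_eq_zero.mp h0, map_one]
    have hν0 := toAdd_eq_zero_of_unramified_of_apply_eq_one hσ₀ ν hνI δ' hδc hδ'I hα hδ1
    rw [hν, h₁, toAdd_one, mul_zero, sub_zero] at hν0
    rcases mul_eq_zero.mp hν0 with h | h
    · exact hτ₁ (Multiplicative.toAdd.injective (by rw [h, toAdd_one]))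
    · exact h₁' (Multiplicative.toAdd.injective (by rw [h, toAdd_one]))
  -- the triangular reduction
  obtain ⟨σ, hσ₁, hσ₂, hu⟩ := h₀
  exact FixReduction.finite_fixed_of_triangular_model ρ Φ χ e δ hΦ (fun σ ↦ κ₁ σ = 1) (fun σ ↦ κ₂ σ = 1) σ₁
    ⟨σ, hσ₁, hσ₂, hu⟩ (hB (δ σ₁ - 1) hδσ₁)

end Summit.BirchSwinnertonDyer.BirchSwinnertonDyer.Theorems.ErratumThm23TwoVariable.FixAssembly

end
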